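import Literature.Computability.ImplicitComplexity.SoftTypeAssignmentWeighted
import HarnessLib

/-!
# `STA₊` weighted derivations are closed under type substitution

Continuation of `SoftTypeAssignmentWeighted.lean` (GMR08 = Gaboardi–Marion–Ronchi Della Rocca 2008;
`STA.WTyping r w d Γ M σ` = `STA₊` typing with degree, rank bound and weight). The substitution
of linear types for type variables throughout a derivation is again a derivation, of the same
subject, degree, rank bound and weight (`WTyping.substT`; GR07's "substitution lemma on types",
used there and in GMR08 to commute `(∀E)` with `(∀I)` in the generation lemma). Corollaries:
renaming of type variables (`WTyping.renameT`) and the type-variable shift of rule `(∀I)`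
(`WTyping.shiftT`).

## References

* [GaboardiMarionRonchidellarocca2008] GMR08, Table 2 (`(∀I)`, `(∀E)`), §3.
* [GaboardiRonchiDellaRocca2007] GR07, §3 (substitution of types in derivations).
-/

namespace Literature.Computability.ImplicitComplexity

namespace STA

namespace WTyping

variable {r : ℕ}

/-- **Type substitution lemma**: `Π ▹ Γ ⊢ M : σ` implies `Π[θ] ▹ Γ[θ] ⊢ M : σ[θ]` with the same
measures. [cite: GaboardiRonchiDellaRocca2007, §3 (substitution lemma on types)] -/
theorem substT {w d : ℕ} {Γ : Ctx} {M : Term} {σ : SoftTy} (h : WTyping r w d Γ M σ) (θ : ℕ → LinTy) :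
    WTyping r w d (Γ.substT θ) M (σ.substT θ) := by
  induction h generalizing θ with
  | ax hΓ => exact WTyping.ax (hΓ.substT θ)
  | weak j A _ hj hΓ' ih =>
    subst hΓ'
    refine WTyping.weak j (A.substp θ) (ih θ) (by simp [hj]) ?_
    rw [Ctx.substT_update]
    rfl
  | lam _ ih =>
    refine WTyping.lam ?_
    have := ih θ
    rwa [Ctx.substT_cons] at this
  | app hs _ _ ih₁ ih₂ => exact WTyping.app (hs.substT θ) (ih₁ θ) (ih₂ θ)
  | @mpx w d Γ Γ' M M' μ σ S j _ hS hj hr hΓ' hM' ih =>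
    subst hΓ' hM'
    refine WTyping.mpx S j (ih θ) (fun i hi => by simp [hS i hi]) (by simp [hj]) hr
      (Ctx.substT_mpx θ Γ S j σ) rfl
  | sp _ hΓ' ih =>
    subst hΓ'
    exact WTyping.sp (ih θ) (Ctx.substT_bang θ _)
  | @allI w d Γ Δ M A _ hΔ ih =>
    subst hΔ
    refine WTyping.allI (ih (LinTy.up θ)) ?_
    exact Ctx.substT_up_shift θ Γ
  | @allE w d Γ M B A _ ih =>
    have h' := WTyping.allE (A.substp θ) (ih θ)
    have e : (SoftTy.substT θ ⟨0, B.inst A⟩) = ⟨0, (B.substp (LinTy.up θ)).inst (A.substp θ)⟩ := by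
      simp [SoftTy.substT, LinTy.inst_substp]
    rw [e]
    exact h'
  | sum _ _ ih₁ ih₂ => exact WTyping.sum (ih₁ θ) (ih₂ θ)

/-- Renaming the type variables of a derivation. [folklore] -/
theorem renameT {w d : ℕ} {Γ : Ctx} {M : Term} {σ : SoftTy} (h : WTyping r w d Γ M σ) (ρ : ℕ → ℕ) :
    WTyping r w d (Γ.renameT ρ) M (σ.renameT ρ) := by
  rw [Ctx.renameT_eq_substT, SoftTy.renameT_eq_substT]
  exact h.substT _

/-- The type-variable shift of rule `(∀I)` applied to a whole derivation. [folklore] -/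
theorem shiftT {w d : ℕ} {Γ : Ctx} {M : Term} {σ : SoftTy} (h : WTyping r w d Γ M σ) :
    WTyping r w d Γ.shift M σ.shift :=
  h.renameT Nat.succ

end WTyping

end STA

end Literature.Computability.ImplicitComplexity
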